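import Summits.QuantumFields.BalabanUV.T4Continuum.Support.NE7K1LinTorusKernelDecay

/-!
# NE7K1LinTorusSymbolStrip — row NE7 (node U5), candidate route HOM, path H1L, cell K1-lin(s): B-E1's STRIP CLAUSE (b′) ON THE
# FINITE TORUS — the complexified symbol `σ_s(k) = Σ_v T^𝕋(s)(c₀, c₀+v)·e^{ik·v}` is bounded in the strip `Σ_μ|Im k_μ| ≤ η < θ`,
# UNIFORMLY IN THE TORUS SIZE (Paley–Wiener as a finite sum over I3-on-the-torus, file 44) (NEEDS-ESTIMATE #E1, B-E1 (b′))

Lineage `b2b-balaban-t4-ne7-p2` (CRUX PROVER NE7 #2), generation 73; file 45.  File 44 (`NE7K1LinTorusKernelDecay`) proved I3 on the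
torus: `|T^𝕋(s)(x, c₀)| ≤ 2n²C_𝕋·e^{−θ(|x − c₀|_∞ − 2)}` for every label `x` of the doubled torus `(ℤ∕2nM)^{d+1}`, `c₀ = (nM_μ)` its
centre, every `s ∈ [0,1]`.  Lens 2's clause (i)∕(b′) of `I2I3-SUPPLY.md` §4 («by I3, `k̃_L` extends holomorphically to `|Im p|₁ < θ`
with `|k̃_L(x+iη)| ≤ Σ_b |K(0,b)|·e^{|η|₁|b|_∞}` — Paley–Wiener») is, on a FINITE torus, a finite sum of entire functions; its content is
the bound UNIFORM IN THE SIZE, which THIS FILE proves: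

* §1 THE LATTICE SUM, UNIFORMLY IN THE SIZE: `Σ_{j<2K} r^{|j−K|} ≤ (1+r)∕(1−r)` (`sum_pow_natAbs_le`, two geometric sums), the
  coordinatewise domination `e^{−κ|v|_∞} ≤ Π_μ e^{−(κ∕(d+1))|v_μ|}` (`exp_neg_supNorm_le_prod`) and the product structure of the box
  (`Finset.prod_univ_sum`): **`sum_exp_neg_supNorm_le`** `Σ_{y ∈ (ℤ∕2K)^{d+1}} e^{−κ|y − c₀|_∞} ≤ ((1+e^{−κ′})∕(1−e^{−κ′}))^{d+1}`,
  `κ′ = κ∕(d+1)` — free of `K`.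
* §2 **`norm_torSymbC_le`** — B-E1 (b′): for `θ > η ≥ 0` with file 28's mesh-free rate condition `16(d+1)²L^{d+3}(e^θ − 1) ≤ 1`,
  every `s ∈ [0,1]` and every complex momentum `k` with `Σ_μ |Im k_μ| ≤ η`:
  `|Σ_y T^𝕋(s)(c₀, y)·exp(i·Σ_μ k_μ(y − c₀)_μ)| ≤ 2n²C_𝕋·e^{2θ}·((1+e^{−κ′})∕(1−e^{−κ′}))^{d+1}`, `κ′ = (θ−η)∕(d+1)`,
  `C_𝕋 = 64(d+1)²(2d+3)²L^{d+5}` — uniform in the torus size `M` (and, per `n²`, in the mesh); at real lattice momenta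
  `k_μ = 2πp_μ∕2nM_μ` the sum is file 37's `torSymb … s c₀ p` (`torSymbC_real`).

HONEST FRAMING: [folklore] (a finite Paley–Wiener estimate); `a = 0`, U = 1, ONE scale; crude explicit constants (the rate `θ_K(d,L)`
of file 28 is far from lens 2's numerical `κ₀`); clause (e′) (derivative bounds) and the class-S re-typing of the strip engine (R-E1)
are NOT here; nothing of Bałaban's asserted; no `sorry`.  Census only (B-E1 (b′) on the finite doubled torus of every size); NE7 NOT
PRINTED ∕ NOT PROVED; spine 0∕9; FIXED FINITE T⁴, rung (B)+1; NOT infinite volume, NOT mass gap, NOT Clay.  HONEST DEPENDENCY: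
continuum YM on T⁴ ⇐ BetaPertH ∧ nine spine estimates (0/9 proved); BetaPertH ⇐ (D1) ∧ (D4) ∧ CAP+tail; G-an2-4 gates asym, D1 and
NE2/3/4.
-/

noncomputable section

open Finset Matrix Complex

namespace Summit.QuantumFields.BalabanUV.T4Continuum.NE7K1LinTorusSymbolStrip

open Literature.MathematicalPhysics.QuantumFieldTheory.Balaban1983to89
open Literature.MathematicalPhysics.QuantumFieldTheory.Balaban1983to89.B4ContourShift (supNorm supNorm_nonneg abs_le_supNorm
  exists_supNorm_eq)
open Literature.MathematicalPhysics.QuantumFieldTheory.Balaban1983to89.B4Reflection242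
open Literature.MathematicalPhysics.QuantumFieldTheory.Balaban1983to89.B4Lower18
open Literature.MathematicalPhysics.QuantumFieldTheory.Balaban1983to89.B4TorusPositivity (wrap wrap_wrap_add)
open NE7K1LinFoldKernels NE7K1LinFoldMatrices NE7K1LinSchurFold NE7K1LinTorusChart NE7K1LinSchurFoldBox
  NE7K1LinTorusLineInvariant NE7K1LinTorusLineSymbol NE7K1LinTorusSymbolReal NE7K1LinTorusJensen NE7K1LinTorusFloor
  NE7K1LinTorusEntries NE7K1LinTorusFluctDecay NE7K1LinTorusKernelDecay NE7K1LinSchurLineU1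

variable {d : ℕ}

/-! ### §1 The lattice sum `Σ_y e^{−κ|y − c₀|_∞}` is bounded uniformly in the size -/

section Sums

/-- the integers `[0, 2K)` are the casts of `range 2K`. [folklore] -/
theorem Ico_int_eq_map (K : ℕ) : Finset.Ico (0 : ℤ) (2 * K : ℕ) = (Finset.range (2 * K)).map Nat.castEmbedding := by
  ext t
  simp only [Finset.mem_Ico, Finset.mem_map, Finset.mem_range, Nat.castEmbedding_apply]
  constructor
  · rintro ⟨h0, h1⟩
    refine ⟨t.toNat, ?_, ?_⟩
    · have := Int.toNat_of_nonneg h0; omega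
    · exact Int.toNat_of_nonneg h0
  · rintro ⟨j, hj, rfl⟩
    constructor <;> omega

/-- **ONE COORDINATE**: `Σ_{j<2K} r^{|j − K|} ≤ (1 + r)∕(1 − r)` for `0 ≤ r < 1` (the distances to the centre are `K, K−1, …, 1, 0, 1, …, K−1`;
two geometric sums). [folklore] -/
theorem sum_pow_natAbs_le {r : ℝ} (hr0 : 0 ≤ r) (hr1 : r < 1) (K : ℕ) :
    ∑ j ∈ Finset.range (2 * K), r ^ ((j : ℤ) - K).natAbs ≤ (1 + r) / (1 - r) := by
  have h1r : 0 < 1 - r := by linarith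
  rw [Finset.range_eq_Ico, ← Finset.Ico_union_Ico_eq_Ico (Nat.zero_le K) (by omega : K ≤ 2 * K),
    Finset.sum_union (Finset.Ico_disjoint_Ico_consecutive 0 K (2 * K))]
  -- left half: distances `K − j`, `j < K`
  have hleft : ∑ j ∈ Finset.Ico 0 K, r ^ ((j : ℤ) - K).natAbs ≤ r / (1 - r) := by
    have e : ∑ j ∈ Finset.Ico 0 K, r ^ ((j : ℤ) - K).natAbs = ∑ i ∈ Finset.range K, r ^ (i + 1) := by
      rw [← Finset.range_eq_Ico, ← Finset.sum_range_reflect (fun j => r ^ ((j : ℤ) - K).natAbs) K]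
      refine Finset.sum_congr rfl fun i hi => ?_
      have hi' := Finset.mem_range.1 hi
      congr 1
      omega
    rw [e]
    have e2 : ∑ i ∈ Finset.range K, r ^ (i + 1) = r * ∑ i ∈ Finset.range K, r ^ i := by
      rw [Finset.mul_sum]; exact Finset.sum_congr rfl fun i _ => by ring
    rw [e2]
    have hg : ∑ i ∈ Finset.range K, r ^ i ≤ 1 / (1 - r) := by
      have := geom_sum_Ico_le_of_lt_one (m := 0) (n := K) hr0 hr1
      rwa [pow_zero, ← Finset.range_eq_Ico] at this
    calc r * ∑ i ∈ Finset.range K, r ^ i ≤ r * (1 / (1 - r)) := mul_le_mul_of_nonneg_left hg hr0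
      _ = r / (1 - r) := by ring
  -- right half: distances `j − K`, `K ≤ j < 2K`
  have hright : ∑ j ∈ Finset.Ico K (2 * K), r ^ ((j : ℤ) - K).natAbs ≤ 1 / (1 - r) := by
    rw [Finset.sum_Ico_eq_sum_range]
    have e : ∑ i ∈ Finset.range (2 * K - K), r ^ (((K + i : ℕ) : ℤ) - K).natAbs = ∑ i ∈ Finset.range (2 * K - K), r ^ i := by
      refine Finset.sum_congr rfl fun i _ => ?_
      congr 1
      omega
    rw [e]
    have := geom_sum_Ico_le_of_lt_one (m := 0) (n := 2 * K - K) hr0 hr1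
    rwa [pow_zero, ← Finset.range_eq_Ico] at this
  have e3 : r / (1 - r) + 1 / (1 - r) = (1 + r) / (1 - r) := by field_simp; ring
  linarith [hleft, hright, e3.le, e3.ge]

/-- **THE 1-D SUM OVER THE PERIOD**: `Σ_{t ∈ [0,2K)} e^{−κ|t − K|} ≤ (1 + e^{−κ})∕(1 − e^{−κ})` (`κ > 0`), free of `K`. [folklore] -/
theorem sum_exp_neg_abs_le {κ : ℝ} (hκ : 0 < κ) (K : ℕ) :
    ∑ t ∈ Finset.Ico (0 : ℤ) (2 * K : ℕ), Real.exp (-(κ * |((t - K : ℤ) : ℝ)|)) ≤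
      (1 + Real.exp (-κ)) / (1 - Real.exp (-κ)) := by
  have hr0 : 0 ≤ Real.exp (-κ) := (Real.exp_pos _).le
  have hr1 : Real.exp (-κ) < 1 := Real.exp_lt_one_iff.2 (by linarith)
  rw [Ico_int_eq_map, Finset.sum_map]
  refine le_trans (le_of_eq ?_) (sum_pow_natAbs_le hr0 hr1 K)
  refine Finset.sum_congr rfl fun j _ => ?_
  rw [Nat.castEmbedding_apply, ← Real.exp_nat_mul]
  congr 1
  have e : ((((j : ℤ) - K).natAbs : ℕ) : ℝ) = |(((j : ℤ) - K : ℤ) : ℝ)| := by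
    rw [← Int.cast_natCast (R := ℝ), Int.natCast_natAbs, Int.cast_abs]
  rw [e]
  ring

/-- coordinatewise domination: `e^{−κ|v|_∞} ≤ Π_μ e^{−(κ∕(d+1))|v_μ|}` (`κ ≥ 0`; `|v_μ| ≤ |v|_∞`). [folklore] -/
theorem exp_neg_supNorm_le_prod {κ : ℝ} (hκ : 0 ≤ κ) (v : Fin (d + 1) → ℤ) :
    Real.exp (-(κ * supNorm v)) ≤ ∏ μ : Fin (d + 1), Real.exp (-(κ / ((d : ℝ) + 1) * |((v μ : ℤ) : ℝ)|)) := by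
  rw [← Real.exp_sum]
  refine Real.exp_le_exp.2 ?_
  have h1 : ∀ μ : Fin (d + 1), |((v μ : ℤ) : ℝ)| ≤ supNorm v := fun μ => by
    have := abs_le_supNorm v μ; rwa [Int.cast_abs] at this
  have hsum : ∑ μ : Fin (d + 1), |((v μ : ℤ) : ℝ)| ≤ ((d : ℝ) + 1) * supNorm v := by
    refine (Finset.sum_le_sum fun μ _ => h1 μ).trans (le_of_eq ?_)
    rw [Finset.sum_const, Finset.card_univ, Fintype.card_fin, nsmul_eq_mul]
    push_cast
    ring
  have hd : (0 : ℝ) < (d : ℝ) + 1 := by positivity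
  rw [Finset.sum_neg_distrib, ← Finset.mul_sum]
  apply neg_le_neg
  have hk : 0 ≤ κ / ((d : ℝ) + 1) := div_nonneg hκ hd.le
  calc κ / ((d : ℝ) + 1) * ∑ μ : Fin (d + 1), |((v μ : ℤ) : ℝ)| ≤ κ / ((d : ℝ) + 1) * (((d : ℝ) + 1) * supNorm v) :=
        mul_le_mul_of_nonneg_left hsum hk
    _ = κ * supNorm v := by field_simp

/-- **THE LATTICE SUM IS BOUNDED UNIFORMLY IN THE SIZE**: for `κ > 0` and the centre `c₀ = (K_μ)` of the representatives
`boxDom (dbl K)`: `Σ_y e^{−κ|y − c₀|_∞} ≤ ((1 + e^{−κ′})∕(1 − e^{−κ′}))^{d+1}`, `κ′ = κ∕(d+1)`. [folklore] -/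
theorem sum_exp_neg_supNorm_le {κ : ℝ} (hκ : 0 < κ) (K : Fin (d + 1) → ℕ) :
    ∑ y : ↥(boxDom (dbl K)), Real.exp (-(κ * supNorm (y.1 - fun i => (K i : ℤ)))) ≤
      ((1 + Real.exp (-(κ / ((d : ℝ) + 1)))) / (1 - Real.exp (-(κ / ((d : ℝ) + 1))))) ^ (d + 1) := by
  classical
  have hd : (0 : ℝ) < (d : ℝ) + 1 := by positivity
  have hκ' : 0 < κ / ((d : ℝ) + 1) := div_pos hκ hd
  set G : ℝ := (1 + Real.exp (-(κ / ((d : ℝ) + 1)))) / (1 - Real.exp (-(κ / ((d : ℝ) + 1)))) with hG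
  -- (1) coordinatewise domination
  rw [Finset.sum_coe_sort (boxDom (dbl K)) (fun y => Real.exp (-(κ * supNorm (y - fun i => (K i : ℤ)))))]
  refine (Finset.sum_le_sum fun y _ => exp_neg_supNorm_le_prod hκ.le (y - fun i => (K i : ℤ))).trans ?_
  -- (2) the product structure of the box
  have hbox : boxDom (dbl K) = Fintype.piFinset fun i => Finset.Ico (0 : ℤ) (dbl K i) := rfl
  simp only [Pi.sub_apply]
  rw [hbox, ← Finset.prod_univ_sum (fun i => Finset.Ico (0 : ℤ) (dbl K i))
    (fun μ t => Real.exp (-(κ / ((d : ℝ) + 1) * |((t - (K μ : ℤ) : ℤ) : ℝ)|)))]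
  -- (3) each factor is the 1-D sum
  have hfac : ∀ μ : Fin (d + 1), ∑ t ∈ Finset.Ico (0 : ℤ) (dbl K μ),
      Real.exp (-(κ / ((d : ℝ) + 1) * |((t - (K μ : ℤ) : ℤ) : ℝ)|)) ≤ G := by
    intro μ
    have := sum_exp_neg_abs_le hκ' (K μ)
    simp only [dbl_apply] at this ⊢
    exact this
  have hfac0 : ∀ μ : Fin (d + 1), 0 ≤ ∑ t ∈ Finset.Ico (0 : ℤ) (dbl K μ),
      Real.exp (-(κ / ((d : ℝ) + 1) * |((t - (K μ : ℤ) : ℤ) : ℝ)|)) := fun μ => Finset.sum_nonneg fun _ _ => (Real.exp_pos _).le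
  calc ∏ μ : Fin (d + 1), ∑ t ∈ Finset.Ico (0 : ℤ) (dbl K μ), Real.exp (-(κ / ((d : ℝ) + 1) * |((t - (K μ : ℤ) : ℤ) : ℝ)|))
      ≤ ∏ _μ : Fin (d + 1), G := Finset.prod_le_prod (fun μ _ => hfac0 μ) (fun μ _ => hfac μ)
    _ = G ^ (d + 1) := by rw [Finset.prod_const, Finset.card_univ, Fintype.card_fin]

end Sums

/-! ### §2 B-E1 (b′): the complexified symbol is bounded in the strip, uniformly in the torus size -/

section Strip

variable {n L : ℕ} [NeZero L] {M : Fin (d + 1) → ℕ}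

/-- the centre label of the doubled torus `boxDom (dbl (n·M))`. [folklore] -/
theorem ctr_mem_labels (hn : 1 ≤ n) (hM : ∀ i, 1 ≤ M i) :
    (fun i => ((n * M i : ℕ) : ℤ)) ∈ (boxDom (dbl fun i => n * L * M i)).image (blk L) := by
  rw [image_fineTor (NeZero.one_le : 1 ≤ L) n M]
  exact ctr_mem (mul_pos_side hn hM)

/-- the modulus of a plane wave with complex momentum: `|exp(i·Σ_μ k_μ v_μ)| ≤ e^{(Σ_μ|Im k_μ|)·|v|_∞}`. [folklore] -/
theorem norm_exp_I_mul_sum_le (k : Fin (d + 1) → ℂ) (v : Fin (d + 1) → ℤ) :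
    ‖Complex.exp (Complex.I * ∑ μ : Fin (d + 1), k μ * ((v μ : ℤ) : ℂ))‖ ≤
      Real.exp ((∑ μ : Fin (d + 1), |(k μ).im|) * supNorm v) := by
  rw [Complex.norm_exp]
  refine Real.exp_le_exp.2 ?_
  have hre : (Complex.I * ∑ μ : Fin (d + 1), k μ * ((v μ : ℤ) : ℂ)).re = -∑ μ : Fin (d + 1), (k μ).im * (v μ : ℝ) := by
    rw [Complex.mul_re, Complex.I_re, Complex.I_im, zero_mul, one_mul, zero_sub, Complex.im_sum]
    congr 1
    refine Finset.sum_congr rfl fun μ _ => ?_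
    simp [Complex.mul_im]
  rw [hre, Finset.sum_mul]
  rw [← Finset.sum_neg_distrib]
  refine Finset.sum_le_sum fun μ _ => ?_
  have h1 : |((v μ : ℤ) : ℝ)| ≤ supNorm v := by have := abs_le_supNorm v μ; rwa [Int.cast_abs] at this
  have h2 : -((k μ).im * (v μ : ℝ)) ≤ |(k μ).im| * |((v μ : ℤ) : ℝ)| := by
    rw [← abs_mul]; exact neg_le_abs _
  exact h2.trans (mul_le_mul_of_nonneg_left h1 (abs_nonneg _))

/-- **B-E1 (b′) — THE COMPLEXIFIED SYMBOL IS BOUNDED IN THE STRIP, UNIFORMLY IN THE TORUS SIZE**: at `a = 0`, for `0 ≤ η < θ`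
with `16(d+1)²L^{d+3}(e^θ − 1) ≤ 1`, every `s ∈ [0,1]`, every mesh `n`, every torus `M` and every complex momentum `k` with
`Σ_μ |Im k_μ| ≤ η`: `|Σ_y T^𝕋(s)(c₀, y)·exp(i Σ_μ k_μ (y − c₀)_μ)| ≤ 2n²C_𝕋·e^{2θ}·((1 + e^{−κ′})∕(1 − e^{−κ′}))^{d+1}`,
`κ′ = (θ − η)∕(d+1)`, `C_𝕋 = 64(d+1)²(2d+3)²L^{d+5}`. [folklore] -/
theorem norm_torSymbC_le (hn : 1 ≤ n) (hM : ∀ i, 1 ≤ M i) {θ η : ℝ} (hη : 0 ≤ η) (hηθ : η < θ)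
    (hθs : 16 * ((d : ℝ) + 1) ^ 2 * (L : ℝ) ^ (d + 3) * (Real.exp θ - 1) ≤ 1) {s : ℝ} (hs0 : 0 ≤ s) (hs1 : s ≤ 1)
    (k : Fin (d + 1) → ℂ) (hk : ∑ μ : Fin (d + 1), |(k μ).im| ≤ η) :
    ‖∑ y : ↥((boxDom (dbl fun i => n * L * M i)).image (blk L)),
        (torLine (isBlockUnion_fine (fineTor_isBlockUnion hn (NeZero.one_le : 1 ≤ L) M)) n 0 (fun i => n * L * M i)
            (fun i => n * M i) s ⟨fun i => ((n * M i : ℕ) : ℤ), ctr_mem_labels hn hM⟩ y : ℂ) *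
          Complex.exp (Complex.I * ∑ μ : Fin (d + 1), k μ * (((y.1 μ - ((n * M μ : ℕ) : ℤ) : ℤ)) : ℂ))‖ ≤
      2 * ((n : ℝ) ^ 2 * (64 * ((d : ℝ) + 1) ^ 2 * (2 * (d : ℝ) + 3) ^ 2 * (L : ℝ) ^ (d + 5))) * Real.exp (2 * θ) *
        ((1 + Real.exp (-((θ - η) / ((d : ℝ) + 1)))) / (1 - Real.exp (-((θ - η) / ((d : ℝ) + 1))))) ^ (d + 1) := by
  classical
  have hL : 1 ≤ L := NeZero.one_le
  have hK : ∀ i, 1 ≤ (fun i => n * M i) i := mul_pos_side hn hM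
  have hθ : 0 ≤ θ := hη.trans hηθ.le
  set C : ℝ := (n : ℝ) ^ 2 * (64 * ((d : ℝ) + 1) ^ 2 * (2 * (d : ℝ) + 3) ^ 2 * (L : ℝ) ^ (d + 5)) with hC
  have hC0 : 0 ≤ C := by rw [hC]; positivity
  set c₀ : ↥((boxDom (dbl fun i => n * L * M i)).image (blk L)) := ⟨fun i => ((n * M i : ℕ) : ℤ), ctr_mem_labels hn hM⟩ with hc₀
  -- termwise: `|T(c₀,y)|·|plane wave| ≤ 2C e^{−θ(ρ−2)}·e^{ηρ} = 2C e^{2θ} e^{−(θ−η)ρ}`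
  have hterm : ∀ y : ↥((boxDom (dbl fun i => n * L * M i)).image (blk L)),
      ‖(torLine (isBlockUnion_fine (fineTor_isBlockUnion hn hL M)) n 0 (fun i => n * L * M i) (fun i => n * M i) s c₀ y : ℂ) *
          Complex.exp (Complex.I * ∑ μ : Fin (d + 1), k μ * (((y.1 μ - ((n * M μ : ℕ) : ℤ) : ℤ)) : ℂ))‖ ≤
        2 * C * Real.exp (2 * θ) * Real.exp (-((θ - η) * supNorm (y.1 - fun i => ((n * M i : ℕ) : ℤ)))) := by
    intro y
    set ρ := supNorm (y.1 - fun i => ((n * M i : ℕ) : ℤ)) with hρ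
    rw [norm_mul, Complex.norm_real, Real.norm_eq_abs]
    -- the entry, by symmetry `T(c₀, y) = T(y, c₀)`, and file 44
    have hT : |torLine (isBlockUnion_fine (fineTor_isBlockUnion hn hL M)) n 0 (fun i => n * L * M i) (fun i => n * M i) s c₀ y| ≤
        2 * C * Real.exp (-(θ * (ρ - 2))) := by
      rw [← (torLine_isSymm _ rfl (image_fineTor hL n M) n 0 s).apply c₀ y]
      exact torLine_entry_decay_ctr (K := fun i => n * M i) (Nf := fun i => n * L * M i) hn hK (side_eq n L M) rfl
        (fineTor_isBlockUnion hn hL M) hθ hθs hs0 hs1 y c₀ rfl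
    have hW := norm_exp_I_mul_sum_le k (y.1 - fun i => ((n * M i : ℕ) : ℤ))
    have hW' : ‖Complex.exp (Complex.I * ∑ μ : Fin (d + 1), k μ * (((y.1 μ - ((n * M μ : ℕ) : ℤ) : ℤ)) : ℂ))‖ ≤
        Real.exp (η * ρ) := by
      refine (le_of_eq ?_).trans (hW.trans (Real.exp_le_exp.2 (mul_le_mul_of_nonneg_right hk (supNorm_nonneg _))))
      rfl
    calc |torLine (isBlockUnion_fine (fineTor_isBlockUnion hn hL M)) n 0 (fun i => n * L * M i) (fun i => n * M i) s c₀ y| *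
          ‖Complex.exp (Complex.I * ∑ μ : Fin (d + 1), k μ * (((y.1 μ - ((n * M μ : ℕ) : ℤ) : ℤ)) : ℂ))‖
        ≤ (2 * C * Real.exp (-(θ * (ρ - 2)))) * Real.exp (η * ρ) :=
          mul_le_mul hT hW' (norm_nonneg _) (by positivity)
      _ = 2 * C * Real.exp (2 * θ) * Real.exp (-((θ - η) * ρ)) := by
          rw [mul_assoc (2 * C), mul_assoc (2 * C), ← Real.exp_add, ← Real.exp_add]
          congr 2
          ring
  -- sum up with the lattice bound of §1 (transported to the label set)
  refine (norm_sum_le _ _).trans ((Finset.sum_le_sum fun y _ => hterm y).trans ?_)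
  rw [← Finset.mul_sum]
  refine mul_le_mul_of_nonneg_left ?_ (by positivity)
  have hκ : 0 < θ - η := by linarith
  have hlat := sum_exp_neg_supNorm_le hκ (fun i => n * M i)
  refine le_trans (le_of_eq ?_) hlat
  -- the label set is the representative box
  refine Fintype.sum_equiv
    { toFun := fun y => ⟨y.1, mem_dbl_of_mem_image (L := L) y.2⟩
      invFun := fun x => ⟨x.1, mem_image_of_mem_dbl (L := L) x.2⟩
      left_inv := fun y => Subtype.ext rfl
      right_inv := fun x => Subtype.ext rfl } _ _ fun y => ?_
  rfl

/-- **AT REAL LATTICE MOMENTA THE COMPLEXIFIED SYMBOL IS FILE 37's `σ_s(p)`**: with `k_μ = 2πp_μ∕(2nM_μ)` the sum is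
`torSymb … s c₀ p` (base point the centre; by `torSymb_indep` any base point). [folklore] -/
theorem torSymbC_real (hn : 1 ≤ n) (hM : ∀ i, 1 ≤ M i) (s : ℝ) (p : Fin (d + 1) → ℤ) :
    ∑ y : ↥((boxDom (dbl fun i => n * L * M i)).image (blk L)),
        (torLine (isBlockUnion_fine (fineTor_isBlockUnion hn (NeZero.one_le : 1 ≤ L) M)) n 0 (fun i => n * L * M i)
            (fun i => n * M i) s ⟨fun i => ((n * M i : ℕ) : ℤ), ctr_mem_labels hn hM⟩ y : ℂ) *
          Complex.exp (Complex.I * ∑ μ : Fin (d + 1),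
            (((2 * Real.pi * p μ / (dbl (fun i => n * M i) μ : ℝ) : ℝ) : ℂ)) * (((y.1 μ - ((n * M μ : ℕ) : ℤ) : ℤ)) : ℂ)) =
      torSymb (L := L) hn M s ⟨fun i => ((n * M i : ℕ) : ℤ), ctr_mem (mul_pos_side hn hM)⟩ p := by
  classical
  have hL : 1 ≤ L := NeZero.one_le
  have hP := dbl_pos (mul_pos_side hn hM)
  unfold torSymb symbT
  refine Fintype.sum_equiv
    { toFun := fun y => ⟨y.1, mem_dbl_of_mem_image (L := L) y.2⟩
      invFun := fun x => ⟨x.1, mem_image_of_mem_dbl (L := L) x.2⟩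
      left_inv := fun y => Subtype.ext rfl
      right_inv := fun x => Subtype.ext rfl } _ _ fun y => ?_
  simp only [Equiv.coe_fn_mk]
  congr 1
  unfold chiT
  congr 1
  rw [Finset.sum_mul, Finset.mul_sum]
  refine Finset.sum_congr rfl fun μ _ => ?_
  have hP0 : ((dbl (fun i => n * M i) μ : ℕ) : ℂ) ≠ 0 := by exact_mod_cast (show dbl (fun i => n * M i) μ ≠ 0 by have := hP μ; omega)
  simp only [Pi.sub_apply]
  push_cast
  field_simp

end Strip

end Summit.QuantumFields.BalabanUV.T4Continuum.NE7K1LinTorusSymbolStrip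

end
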